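import Literature.MathematicalPhysics.QuantumFieldTheory.Balaban1983to89.Node00.CarriersZ
import Literature.MathematicalPhysics.QuantumFieldTheory.Balaban1983to89.Node00.Record10

/-!
# NODE 00 (YM-PLAN Track A) — THE CUMULATIVE CARRIER PIN AT STAGE 10: `IsRecordOfRecord₁₀CB10YZ → IsRecordOfRecord₁₀C` — def-T's β-re-pointed record
# (`Node00/Record10`: `Stage9Params.toStage5₁₀`, `Provisos₁₀` with the β-version proviso `contT`, `datumOfRecord₁₀`) with the world's upstream block bound over
# the Stage-10 view pinned by the [B10] run family of record (`pinB10`), def-Y's [B9] bundle of record (`pinY (Y9OfRecord …)`) and the [B11] bundle of record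
# (`pinZ (Z11OfRecord …)`); the three pins pass through the Stage-10 view and provisos (`rfl` ∕ field by field); faces N06 ∕ N07 ∕ N08 at such a record

NODE 00 CARRIER MODULE, the assembling module at the current machine stage (seat `pub-ymgap-node00-def` g30, 2026-08-26; NAME-SPLIT agreed with def-T and the
dag-lead, pub-ymgap INBOX l.11062 ∕ l.11108: machine-side successors keep the integer stages — def-T's `Record10` = the β RE-POINT —, carrier pins are SUFFIX letters
and ONE module restates the cumulative pin at the current machine stage: this file).  APPEND-ONLY: a NEW importing module; `Record10` (def-T), `CarriersB10` ∕
`CarriersY` ∕ `CarriersZ` (this lineage), def-Y's and n07-a's modules untouched and CONSUMED BY NAME.  The recipe is `STAGE10-CARRIERS-DESIGN-g29.md` §1: a carrier pin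
is a function `Residual₅ → Residual₅` on ONE carrier field, so it COMMUTES with every machine stage — here with Stage 10: `residualOfStage10` overwrites `V`, `βfun`,
`χ`, `E` and the four action ∕ format fields and KEEPS `X`, `Y`, `Z` (`toStage5₁₀_pinB10 ∕ _pinY ∕ _pinZ : rfl`); the seven displayed provisos `Provisos₁₀` (incl.
`contT`) read no carrier (`Provisos₁₀.pinB10 ∕ …`); the datum is unchanged (`datumOfRecord₁₀_pinB10 ∕ … : rfl`).

WHAT IS DEFINED.  `Stage9Params.view₁₀B10YZ θ Mstar ops ζ` — the Stage-10 view `θ.toStage5₁₀` pinned by `pinB10`, then `pinY (Y9OfRecord N θ₃ Mstar ops)`, then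
`pinZ (Z11OfRecord F N ζ)`; **`IsRecordOfRecord₁₀CB10YZ D w`** — `IsRecordOfRecord₁₀C` VERBATIM except that `w.up P = upOfRecord₅C (θ.view₁₀B10YZ Mstar ops ζ) P` for SOME
floor `Mstar`, operator layer `ops : OpsY N θ₃ Mstar` (def-Y's residual) and residual [B11] layer `ζ : ResidZ F N` (this lineage's residual), quantified with the record's
parameters, no law assumed.  WHAT IS PROVED (kernel bookkeeping).  Refinement **`isRecordOfRecord₁₀C_of_isRecordOfRecord₁₀CB10YZ`** WITH THE SAME DATUM AND WORLD
(witness `((θ.pinB10).pinY _).pinZ _`), hence def-T's `₅C`-at-the-shadow transfer of every world-reading node theorem (`atWorld_of_isRecordOfRecord₁₀CB10YZ`);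
inhabitation = `IsRecordOfRecord₁₀C`'s exactly (`exists_world_isRecordOfRecord₁₀CB10YZ`: any admissible `θ` with `Provisos₁₀`, ANY `Mstar ∕ ops ∕ ζ`); THE THREE
PINNED LEAVES at such a record for one parameter package (`leaves_b9_b10_b11_iff_of_…`: `b9 ↔ B9LeafX (Y9OfRecord …)`, `b10 ↔ PrintedUV3V N θ.L`, `b11 ↔ B11Leaf
(Z11OfRecord F N ζ)`); N08 EXACTLY (`b10_main_iff_of_…`), N07 at the bundles (`b11_main_iff_bundles_of_…`), and the G₈a feed of the [B11] leaf by name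
(`G8a_of_leaf_b11_of_isRecordOfRecord₁₀CB10YZ`: def-B's `UkExistsR ∕ UniqueUkOrbitR F N (regB11 F N)` at every torus, level `k ≤ K`, radius `B₃ε₁`).

HONESTY (R433 ∕ RIDERS №5–№7, said once more at ₁₀): the [B10] leaf at such a record is print's slot `PrintedUV3V` (sound); the [B9] leaf is def-Y's leaf at the bundle of
record — geometry discharged by name, operator layer `ops` RESIDUAL (junk-closable); the [B11] leaf's `t1` is Theorem 1 at NODE 00's objects (GENUINE (8) + uniqueness,
FEEDING G₈a) with the regularity data and `p2…p9`, `sF` RESIDUAL (junk both ways, `CarriersZ.exists_residZ_not_b11Leaf`); `W` and `X`'s [B8] ∕ [B12] ∕ [B13] groups are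
still free data; the format slots `S218 ∕ ScorrLaw` are def-T's residual (FORMAT FACE №38); RIDER №7: N-generic, no K0 stated.  HONEST FRAMING: definitions + kernel
bookkeeping; NO estimate; nothing of Bałaban's asserted; no node count moves (5∕27); one finite T⁴ programme at fixed ε — NOT continuum ∕ ℝ⁴ ∕ infinite volume ∕
OS ∕ mass gap ∕ Clay.  No `sorry`, no `axiom`, no `opaque`, no `instance`, no `notation`. -/

noncomputable section

namespace Literature.MathematicalPhysics.QuantumFieldTheory.Balaban1983to89.Node00

open T4Continuum AveragingRT T4FiniteEpsInhabited FlowStep FlowStepRuns DagBinding T4DatumAssembly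
open scoped Matrix.Norms.L2Operator

/-! ## §1. The three carrier pins pass through the Stage-10 view, provisos and datum -/

section Pins

variable (F : T4Family) (N : ℕ) [NeZero N]

/-- The Stage-10 view of [B10]-pinned parameters IS the [B10]-pinned Stage-10 view (`rfl`: `residualOfStage10` keeps `X`). [cite: Balaban1985UV3, (1)–(5) p.256 (bookkeeping)] -/
theorem Stage9Params.toStage5₁₀_pinB10 (θ : Stage9Params F N) : (θ.pinB10 F N).toStage5₁₀ F N = (θ.toStage5₁₀ F N).pinB10 F N := rfl

/-- The Stage-10 view of Y-pinned parameters IS the Y-pinned Stage-10 view (`rfl`: `residualOfStage10` keeps `Y`). [cite: Balaban1985BackgroundPropagators, Thm 3.1 p.397 (bookkeeping)] -/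
theorem Stage9Params.toStage5₁₀_pinY (θ : Stage9Params F N) (Y₀ : PrintedCarriers9X) :
    (θ.pinY F N Y₀).toStage5₁₀ F N = (θ.toStage5₁₀ F N).pinY F N Y₀ := rfl

/-- The Stage-10 view of Z-pinned parameters IS the Z-pinned Stage-10 view (`rfl`: `residualOfStage10` keeps `Z`). [cite: Balaban1985Variational, Thm 1 p.279 (bookkeeping)] -/
theorem Stage9Params.toStage5₁₀_pinZ (θ : Stage9Params F N) (Z₀ : PrintedCarriers11) :
    (θ.pinZ F N Z₀).toStage5₁₀ F N = (θ.toStage5₁₀ F N).pinZ F N Z₀ := rfl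

variable {F N}

/-- The Stage-10 provisos (incl. the β-version proviso `contT`) read no carrier: they transport along the [B10] pin, field by field … [cite: Balaban1988Convergent, (3.2)–(3.9) pp.265–266; Balaban1987RG1, (0.19) p.255 (the displayed provisos; bookkeeping)] -/
theorem Stage9Params.Provisos₁₀.pinB10 {θ : Stage9Params F N} (h : θ.Provisos₁₀) : (θ.pinB10 F N).Provisos₁₀ :=
  ⟨h.intPiece, h.measω, h.measChi, h.zetaUnity, h.zetaAbs, fun p k _ hk => h.rstep p k hk, h.contT⟩

/-- … along the Y pin … [cite: Balaban1988Convergent, (3.2)–(3.9) pp.265–266 (bookkeeping)] -/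
theorem Stage9Params.Provisos₁₀.pinY {θ : Stage9Params F N} (h : θ.Provisos₁₀) (Y₀ : PrintedCarriers9X) : (θ.pinY F N Y₀).Provisos₁₀ :=
  ⟨h.intPiece, h.measω, h.measChi, h.zetaUnity, h.zetaAbs, fun p k _ hk => h.rstep p k hk, h.contT⟩

/-- … and along the Z pin. [cite: Balaban1988Convergent, (3.2)–(3.9) pp.265–266 (bookkeeping)] -/
theorem Stage9Params.Provisos₁₀.pinZ {θ : Stage9Params F N} (h : θ.Provisos₁₀) (Z₀ : PrintedCarriers11) : (θ.pinZ F N Z₀).Provisos₁₀ :=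
  ⟨h.intPiece, h.measω, h.measChi, h.zetaUnity, h.zetaAbs, fun p k _ hk => h.rstep p k hk, h.contT⟩

variable (F N)

/-- THE PINS ARE UP-SIDE at Stage 10: the datum of record is unchanged by the [B10] pin (`rfl`) … [cite: Balaban1989LargeFieldII, Thm 1 + (0.1) pp.355–356 (bookkeeping)] -/
theorem datumOfRecord₁₀_pinB10 (θ : Stage9Params F N) (h : θ.Provisos₁₀) :
    datumOfRecord₁₀ F N (θ.pinB10 F N) h.pinB10 = datumOfRecord₁₀ F N θ h := rfl

/-- … by the Y pin (`rfl`) … [cite: Balaban1989LargeFieldII, Thm 1 + (0.1) pp.355–356 (bookkeeping)] -/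
theorem datumOfRecord₁₀_pinY (θ : Stage9Params F N) (h : θ.Provisos₁₀) (Y₀ : PrintedCarriers9X) :
    datumOfRecord₁₀ F N (θ.pinY F N Y₀) (h.pinY Y₀) = datumOfRecord₁₀ F N θ h := rfl

/-- … and by the Z pin (`rfl`). [cite: Balaban1989LargeFieldII, Thm 1 + (0.1) pp.355–356 (bookkeeping)] -/
theorem datumOfRecord₁₀_pinZ (θ : Stage9Params F N) (h : θ.Provisos₁₀) (Z₀ : PrintedCarriers11) :
    datumOfRecord₁₀ F N (θ.pinZ F N Z₀) (h.pinZ Z₀) = datumOfRecord₁₀ F N θ h := rfl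

/-- **The cumulative pinned Stage-10 view** of Stage-9 parameters: `θ.toStage5₁₀` pinned by `pinB10`, THEN `pinY (Y9OfRecord …)` (floor `Mstar`, operator layer `ops`),
THEN `pinZ (Z11OfRecord F N ζ)` — what the world's upstream block is bound over at a record of this module.
[cite: Balaban1985UV3, Thm 1 p.257; Balaban1985BackgroundPropagators, Thm 3.1 p.397; Balaban1985Variational, Thm 1 p.279 (objects of record)] -/
def Stage9Params.view₁₀B10YZ (θ : Stage9Params F N) (Mstar : ℕ) (ops : OpsY N θ.toStage3Params Mstar) (ζ : ResidZ F N) : Stage5Params F N :=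
  (((θ.toStage5₁₀ F N).pinB10 F N).pinY F N (Y9OfRecord N θ.toStage3Params Mstar ops)).pinZ F N (Z11OfRecord F N ζ)

/-- The cumulative view IS the Stage-10 view of the TRIPLY PINNED parameters (`rfl`: the identity behind the same-world refinement). [cite: Balaban1989LargeFieldII, Thm 1 p.355 (bookkeeping)] -/
theorem Stage9Params.view₁₀B10YZ_eq (θ : Stage9Params F N) (Mstar : ℕ) (ops : OpsY N θ.toStage3Params Mstar) (ζ : ResidZ F N) :
    θ.view₁₀B10YZ F N Mstar ops ζ =
      (((θ.pinB10 F N).pinY F N (Y9OfRecord N θ.toStage3Params Mstar ops)).pinZ F N (Z11OfRecord F N ζ)).toStage5₁₀ F N := by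
  rw [Stage9Params.toStage5₁₀_pinZ, Stage9Params.toStage5₁₀_pinY, Stage9Params.toStage5₁₀_pinB10]
  rfl

/-- The leaves of the C-binding over the cumulative Stage-10 view, by name: `b11 ↔ B11Leaf (Z11OfRecord F N ζ)`, `b9 ↔ B9LeafX (Y9OfRecord …)`, `b10 ↔ PrintedUV3V N θ.L`.
[cite: Balaban1985Variational, Thm 1 p.279; Balaban1985BackgroundPropagators, Thms 3.1–3.15 pp.397–432; Balaban1985UV3, Thm 1 p.257 + Thm 2 p.272] -/
theorem upOfRecord₅C_view₁₀B10YZ_leaves (θ : Stage9Params F N) (Mstar : ℕ) (ops : OpsY N θ.toStage3Params Mstar) (ζ : ResidZ F N) (P : B12.RunParams) :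
    ((upOfRecord₅C F N (θ.view₁₀B10YZ F N Mstar ops ζ) P).b11 ↔ B11Leaf (Z11OfRecord F N ζ)) ∧
    ((upOfRecord₅C F N (θ.view₁₀B10YZ F N Mstar ops ζ) P).b9 ↔ B9LeafX (Y9OfRecord N θ.toStage3Params Mstar ops)) ∧
    ((upOfRecord₅C F N (θ.view₁₀B10YZ F N Mstar ops ζ) P).b10 ↔ PrintedUV3V N θ.L) := by
  refine ⟨upOfRecord₅C_pinZ_b11_iff F N _ _ P, ?_, ?_⟩
  · unfold Stage9Params.view₁₀B10YZ
    rw [upOfRecord₅C_pinZ_b9]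
    exact upOfRecord₅C_pinY_b9_iff F N _ _ P
  · unfold Stage9Params.view₁₀B10YZ
    rw [upOfRecord₅C_pinZ_b10, upOfRecord₅C_pinY_b10]
    exact upOfRecord₅C_pinB10_b10_iff F N (θ.toStage5₁₀ F N) P

end Pins

/-! ## §2. The cumulative record at Stage 10: `IsRecordOfRecord₁₀CB10YZ` -/

section Record10

variable (F : T4Family) (N : ℕ) [NeZero N]

/-- **«(D, w) is the record, Stage 10, [B10], [B9] and [B11] groups pinned»** (CUMULATIVE, at the β-re-pointed machine stage): def-T's `IsRecordOfRecord₁₀C` VERBATIM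
except that the upstream block is the C-binding at the cumulative view `view₁₀B10YZ θ Mstar ops ζ` for SOME floor, SOME operator layer and SOME residual [B11] layer
(residual data, quantified with the record's parameters; no law on them is assumed). [cite: Balaban1985UV3, Thm 1 p.257 + Thm 2 p.272; Balaban1985BackgroundPropagators, Thms 3.1–3.15 pp.397–432; Balaban1985Variational, Thm 1 p.279 + Props 2–9 pp.281–309; Balaban1989LargeFieldII, Thm 1 + (0.1) pp.355–356; Balaban1987RG1, (1.20)–(1.22) p.264 (objects of record)] -/
def IsRecordOfRecord₁₀CB10YZ (D : FiniteEpsData F (SU N)) (w : WorldP) : Prop :=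
  ∃ (θ : Stage9Params F N) (h : θ.Provisos₁₀) (Mstar : ℕ) (ops : OpsY N θ.toStage3Params Mstar) (ζ : ResidZ F N),
    θ.Admissible ∧ D = datumOfRecord₁₀ F N θ h ∧ w.C = D.C ∧ (0 < w.γ ∧ w.γ ≤ θ.γ) ∧ w.L = (θ.L : ℝ) ∧
      ∀ P : B12.RunParams, w.up P = upOfRecord₅C F N (θ.view₁₀B10YZ F N Mstar ops ζ) P

/-- Pointed form. [cite: Balaban1989LargeFieldII, Thm 1 + (0.1) pp.355–356 (bookkeeping)] -/
theorem isRecordOfRecord₁₀CB10YZ_of_eq (θ : Stage9Params F N) (h : θ.Provisos₁₀) (hθ : θ.Admissible) (Mstar : ℕ) (ops : OpsY N θ.toStage3Params Mstar)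
    (ζ : ResidZ F N) (w : WorldP) (hC : w.C = (datumOfRecord₁₀ F N θ h).C) (hγ : 0 < w.γ ∧ w.γ ≤ θ.γ) (hL : w.L = (θ.L : ℝ))
    (hup : ∀ P, w.up P = upOfRecord₅C F N (θ.view₁₀B10YZ F N Mstar ops ζ) P) :
    IsRecordOfRecord₁₀CB10YZ F N (datumOfRecord₁₀ F N θ h) w :=
  ⟨θ, h, Mstar, ops, ζ, hθ, rfl, hC, hγ, hL, hup⟩

/-- **Inhabitation is Stage 10's EXACTLY**: every admissible Stage-9 parameter with its Stage-10 provisos, ANY floor, ANY operator layer and ANY residual [B11] layer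
give a record of this module at some world, any window `0 < γw ≤ θ.γ` (the pins add data, no proviso, no admissibility clause; RIDER №7: N-generic, no K0 stated).
[cite: Balaban1989LargeFieldII, Thm 1 + (0.1) pp.355–356 (bookkeeping)] -/
theorem exists_world_isRecordOfRecord₁₀CB10YZ (θ : Stage9Params F N) (h : θ.Provisos₁₀) (hθ : θ.Admissible) (Mstar : ℕ)
    (ops : OpsY N θ.toStage3Params Mstar) (ζ : ResidZ F N) {γw : ℝ} (hγw : 0 < γw ∧ γw ≤ θ.γ) :
    ∃ w : WorldP, IsRecordOfRecord₁₀CB10YZ F N (datumOfRecord₁₀ F N θ h) w ∧ w.γ = γw := by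
  obtain ⟨w₀, -, -⟩ := exists_world_isRecordOfRecord₁₀C F N θ h hθ hγw
  exact ⟨{ w₀ with
      C := (datumOfRecord₁₀ F N θ h).C, γ := γw, L := (θ.L : ℝ), one_lt_L := by exact_mod_cast θ.hL.2,
      up := fun P => upOfRecord₅C F N (θ.view₁₀B10YZ F N Mstar ops ζ) P },
    ⟨θ, h, Mstar, ops, ζ, hθ, rfl, rfl, hγw, rfl, fun _ => rfl⟩, rfl⟩

variable {F N}
variable {D : FiniteEpsData F (SU N)} {w : WorldP}

/-- **Refinement `IsRecordOfRecord₁₀CB10YZ → IsRecordOfRecord₁₀C`** with THE SAME datum AND world: witness the triply pinned parameters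
`((θ.pinB10).pinY (Y9OfRecord …)).pinZ (Z11OfRecord …)` (provisos transported field by field, datum `rfl`, view `rfl`). [cite: Balaban1989LargeFieldII, Thm 1 + (0.1) pp.355–356 (bookkeeping)] -/
theorem isRecordOfRecord₁₀C_of_isRecordOfRecord₁₀CB10YZ (h : IsRecordOfRecord₁₀CB10YZ F N D w) : IsRecordOfRecord₁₀C F N D w := by
  obtain ⟨θ, hP, Mstar, ops, ζ, hθ, hD, hC, hγ, hL, hup⟩ := h
  have h₁ : (θ.pinB10 F N).Provisos₁₀ := Stage9Params.Provisos₁₀.pinB10 hP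
  have h₂ : ((θ.pinB10 F N).pinY F N (Y9OfRecord N θ.toStage3Params Mstar ops)).Provisos₁₀ := Stage9Params.Provisos₁₀.pinY h₁ _
  have hθ' : (((θ.pinB10 F N).pinY F N (Y9OfRecord N θ.toStage3Params Mstar ops)).pinZ F N (Z11OfRecord F N ζ)).Admissible :=
    (Stage9Params.pinZ_admissible_iff F N _ _).2 ((Stage9Params.pinY_admissible_iff F N _ _).2 ((Stage9Params.pinB10_admissible_iff F N _).2 hθ))
  refine ⟨_, Stage9Params.Provisos₁₀.pinZ h₂ (Z11OfRecord F N ζ), hθ', ?_, hC, hγ, hL, fun P => ?_⟩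
  · rw [datumOfRecord₁₀_pinZ F N _ h₂, datumOfRecord₁₀_pinY F N _ h₁, datumOfRecord₁₀_pinB10 F N θ hP]
    exact hD
  · rw [hup P, Stage9Params.view₁₀B10YZ_eq]

/-- The `atWorld` transfer (def-T's `atWorld_of_isRecordOfRecord₁₀C` by name): every world-reading node theorem over `IsRecordOfRecord₅C` holds at every record of this
module. [cite: Balaban1989LargeFieldII, Thm 1 p.355 (bookkeeping)] -/
theorem atWorld_of_isRecordOfRecord₁₀CB10YZ {X : Dag.Leaves → Prop}
    (h₅ : ∀ (D : FiniteEpsData F (SU N)) (w : WorldP), IsRecordOfRecord₅C F N D w → ∀ P : B12.RunParams, X (leavesP w P))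
    (h : IsRecordOfRecord₁₀CB10YZ F N D w) (P : B12.RunParams) : X (leavesP w P) :=
  atWorld_of_isRecordOfRecord₁₀C h₅ (isRecordOfRecord₁₀C_of_isRecordOfRecord₁₀CB10YZ h) P

/-- Conversely, RE-BINDING a `₁₀C` record's world by the cumulative view (any floor, operator layer, residual [B11] layer) gives a record of this module with the SAME
datum. [cite: Balaban1989LargeFieldII, Thm 1 p.355 (bookkeeping)] -/
theorem isRecordOfRecord₁₀CB10YZ_rebind_of_isRecordOfRecord₁₀C (h : IsRecordOfRecord₁₀C F N D w) :
    ∃ (θ : Stage9Params F N) (_ : θ.Provisos₁₀), θ.Admissible ∧ (∀ P, w.up P = upOfRecord₅C F N (θ.toStage5₁₀ F N) P) ∧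
      ∀ (Mstar : ℕ) (ops : OpsY N θ.toStage3Params Mstar) (ζ : ResidZ F N),
        IsRecordOfRecord₁₀CB10YZ F N D { w with up := fun P => upOfRecord₅C F N (θ.view₁₀B10YZ F N Mstar ops ζ) P } := by
  obtain ⟨θ, hP, hθ, hD, hC, hγ, hL, hup⟩ := h
  exact ⟨θ, hP, hθ, hup, fun Mstar ops ζ => ⟨θ, hP, Mstar, ops, ζ, hθ, hD, hC, hγ, hL, fun _ => rfl⟩⟩

/-- **THE THREE PINNED LEAVES AT A RECORD OF THIS MODULE, for ONE parameter package**: `b9 ↔` def-Y's leaf at `Y9OfRecord`, `b10 ↔ PrintedUV3V N θ.L`,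
`b11 ↔ B11Leaf (Z11OfRecord F N ζ)`. [cite: Balaban1985Variational, Thm 1 p.279; Balaban1985BackgroundPropagators, Thm 3.1 p.397; Balaban1985UV3, Thm 1 p.257] -/
theorem leaves_b9_b10_b11_iff_of_isRecordOfRecord₁₀CB10YZ (h : IsRecordOfRecord₁₀CB10YZ F N D w) :
    ∃ (θ : Stage9Params F N) (Mstar : ℕ) (ops : OpsY N θ.toStage3Params Mstar) (ζ : ResidZ F N), θ.Admissible ∧ w.L = (θ.L : ℝ) ∧
      ∀ P : B12.RunParams,
        ((leavesP w P).b9 ↔ B9LeafX (Y9OfRecord N θ.toStage3Params Mstar ops)) ∧ ((leavesP w P).b10 ↔ PrintedUV3V N θ.L) ∧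
        ((leavesP w P).b11 ↔ B11Leaf (Z11OfRecord F N ζ)) := by
  obtain ⟨θ, -, Mstar, ops, ζ, hθ, -, -, -, hL, hup⟩ := h
  refine ⟨θ, Mstar, ops, ζ, hθ, hL, fun P => ?_⟩
  have hl := upOfRecord₅C_view₁₀B10YZ_leaves F N θ Mstar ops ζ P
  refine ⟨?_, ?_, ?_⟩
  · show (w.up P).b9 ↔ _
    rw [hup P]; exact hl.2.1
  · show (w.up P).b10 ↔ _
    rw [hup P]; exact hl.2.2
  · show (w.up P).b11 ↔ _
    rw [hup P]; exact hl.1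

/-- **N08 at a record of this module, EXACTLY** (the shape of `b10_main_iff_of_isRecordOfRecord₉CB10`): ⟺ «the in-edge leaves imply print's [B10] slot at the
world's block size». [cite: Balaban1985UV3, Thm 1 p.257 + Thm 2 p.272 (the node's shape `Dag.B10_main`, bookkeeping)] -/
theorem b10_main_iff_of_isRecordOfRecord₁₀CB10YZ (h : IsRecordOfRecord₁₀CB10YZ F N D w) :
    ∃ L : ℕ, (Odd L ∧ 1 < L) ∧ w.L = (L : ℝ) ∧ ∀ P : B12.RunParams,
      (Dag.B10_main (leavesP w P) ↔
        ((leavesP w P).b5 → (leavesP w P).b6 → (leavesP w P).b7 → (leavesP w P).b8 → (leavesP w P).b9 → (leavesP w P).b11 →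
          PrintedUV3V N L)) := by
  obtain ⟨θ, Mstar, ops, ζ, -, hwL, hl⟩ := leaves_b9_b10_b11_iff_of_isRecordOfRecord₁₀CB10YZ h
  refine ⟨θ.L, θ.hL, hwL, fun P => ?_⟩
  unfold Dag.B10_main
  rw [(hl P).2.1]

/-- **N08 at every record of this module, FROM THE SLOT OF RECORD** (in-edges unused). [cite: Balaban1985UV3, Thm 1 p.257 (compact reading) + Thm 2 p.272] -/
theorem b10_main_of_isRecordOfRecord₁₀CB10YZ (hUV : ∀ L : ℕ, Odd L → 1 < L → PrintedUV3V N L) (h : IsRecordOfRecord₁₀CB10YZ F N D w)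
    (P : B12.RunParams) : Dag.B10_main (leavesP w P) := by
  obtain ⟨L, hL, -, hiff⟩ := b10_main_iff_of_isRecordOfRecord₁₀CB10YZ h
  exact (hiff P).2 fun _ _ _ _ _ _ => hUV L hL.1 hL.2

/-- **N07 AT A RECORD OF THIS MODULE, AT THE BUNDLES OF RECORD**: for one parameter package `(θ, Mstar, ops, ζ)`, at every run
`Dag.B11_main (leavesP w P) ↔ (b8 → B9LeafX (Y9OfRecord N θ₃ Mstar ops) → B11Leaf (Z11OfRecord F N ζ))` (n07-a's `b11_main_iff_of_isRecordOfRecord₅C` transferred along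
def-T's shadow refinement: `b4 b5 b6 b7` are theorems of the record). [cite: Balaban1985Variational, Thm 1 p.279, Props 2–9 pp.281–309 (bookkeeping: the node at a record)] -/
theorem b11_main_iff_bundles_of_isRecordOfRecord₁₀CB10YZ (h : IsRecordOfRecord₁₀CB10YZ F N D w) :
    ∃ (θ : Stage9Params F N) (Mstar : ℕ) (ops : OpsY N θ.toStage3Params Mstar) (ζ : ResidZ F N), θ.Admissible ∧ w.L = (θ.L : ℝ) ∧
      ∀ P : B12.RunParams,
        (Dag.B11_main (leavesP w P) ↔
          ((leavesP w P).b8 → B9LeafX (Y9OfRecord N θ.toStage3Params Mstar ops) → B11Leaf (Z11OfRecord F N ζ))) := by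
  obtain ⟨θ, Mstar, ops, ζ, hθ, hL, hl⟩ := leaves_b9_b10_b11_iff_of_isRecordOfRecord₁₀CB10YZ h
  refine ⟨θ, Mstar, ops, ζ, hθ, hL, fun P => ?_⟩
  have h57 : Dag.B11_main (leavesP w P) ↔ ((leavesP w P).b8 → (leavesP w P).b9 → (leavesP w P).b11) :=
    atWorld_of_isRecordOfRecord₁₀CB10YZ (X := fun ℓ => Dag.B11_main ℓ ↔ (ℓ.b8 → ℓ.b9 → ℓ.b11))
      (fun _ _ h5 P => B11LeafUnpinnedRecord.b11_main_iff_of_isRecordOfRecord₅C h5 P) h P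
  rw [h57, (hl P).1, (hl P).2.2]

/-- **N06 ∕ N07 ∕ N08 «SLOTS» FORM at a record of this module**: if for every parameter package presenting `(D, w)` as a record of this module the [B9] AND the [B11]
leaves hold at the bundles of record, then `Dag.B9_main` and `Dag.B11_main` hold at every run.  The hypotheses quantify over the HIDDEN residual layers — honest.
[cite: Balaban1985BackgroundPropagators, Thms 3.1–3.15 pp.397–432; Balaban1985Variational, Thm 1 p.279, Props 2–9 pp.281–309 (the nodes' shapes, bookkeeping)] -/
theorem b9_b11_main_of_isRecordOfRecord₁₀CB10YZ_of_slots (h : IsRecordOfRecord₁₀CB10YZ F N D w)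
    (hYZ : ∀ (θ : Stage9Params F N) (hP : θ.Provisos₁₀) (Mstar : ℕ) (ops : OpsY N θ.toStage3Params Mstar) (ζ : ResidZ F N), θ.Admissible →
      D = datumOfRecord₁₀ F N θ hP → (∀ P, w.up P = upOfRecord₅C F N (θ.view₁₀B10YZ F N Mstar ops ζ) P) →
        B9LeafX (Y9OfRecord N θ.toStage3Params Mstar ops) ∧ B11Leaf (Z11OfRecord F N ζ))
    (P : B12.RunParams) : Dag.B9_main (leavesP w P) ∧ Dag.B11_main (leavesP w P) := by
  obtain ⟨θ, hP, Mstar, ops, ζ, hθ, hD, -, -, -, hup⟩ := h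
  have hl := upOfRecord₅C_view₁₀B10YZ_leaves F N θ Mstar ops ζ P
  have hyz := hYZ θ hP Mstar ops ζ hθ hD hup
  refine ⟨fun _ _ _ _ => ?_, fun _ _ _ _ _ => ?_⟩
  · show (w.up P).b9
    rw [hup P]; exact hl.2.1.2 hyz.1
  · show (w.up P).b11
    rw [hup P]; exact hl.1.2 hyz.2

/-- **WHAT N07's LEAF AT A RECORD OF THIS MODULE FEEDS THE STAGE-₈ LAYER, BY NAME**: if the world's `b11` leaf holds at some run, then the G₈a letters of
`Node00/BackgroundActionReg` hold AT THE (2)-CLASS `regB11` — solvability AND orbit-uniqueness of the background-field problem on every torus of the family, every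
level `k ≤ K`, radius `B₃ε₁`, `0 < ε₁ ≤ a₁`, every `V` with (7) (`CarriersZ.G8a_of_b11Leaf_Z11OfRecord`). [cite: Balaban1985Variational, Thm 1 p.279; Balaban1987RG1, (1.1)–(1.2) p.260] -/
theorem G8a_of_leaf_b11_of_isRecordOfRecord₁₀CB10YZ (h : IsRecordOfRecord₁₀CB10YZ F N D w) {P : B12.RunParams} (hb : (leavesP w P).b11) :
    ∃ C : B11Thm1.Consts, ∀ (K k : ℕ), k ≤ K → ∀ ε₁ : ℝ, 0 < ε₁ → ε₁ ≤ C.a₁ → ∀ V : GaugeField (F.P K) k (SU N), PlaqSmall ε₁ V →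
      UkExistsR F N (regB11 F N) K k (C.B₃ * ε₁) V ∧ UniqueUkOrbitR F N (regB11 F N) K k (C.B₃ * ε₁) V := by
  obtain ⟨θ, Mstar, ops, ζ, -, -, hl⟩ := leaves_b9_b10_b11_iff_of_isRecordOfRecord₁₀CB10YZ h
  exact G8a_of_b11Leaf_Z11OfRecord (((hl P).2.2).1 hb)

end Record10

end Literature.MathematicalPhysics.QuantumFieldTheory.Balaban1983to89.Node00

end
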